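import Summits.QuantumFields.YangMills.Theorems.UnitScaleTiltProp8FlatPortKernelRowsL0
import HarnessLib

/-!
# Route `UnitScaleTilt`, crux K1 child «MinimiserStabilityRegPr» (stmt-QuantumFields-19200), stub H `stub_halvingStep`, the (165)-A₁ row's dressing letter `C_E`:
# **WANTED №g26-1 (X1) AT EVERY ADMISSIBLE P2 DATUM** — the `∂^{η*}∂^η`-sup row of the canonical `H = GQ*(QGQ*)⁻¹` in plain-sup currency,
# `w₃(b)·|(∂^{η*}∂^η flatH X)(b)| ≤ C_X·sup_c|X(c)|`, WITH `C_X` A FUNCTION OF `L` ALONE, for every charted family `domT hN D hk` of the d = 3 carrier (odd `L ≥ 5`,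
# `k = K − n ≥ 1`) and hence for every `Adm22` family — the port twin of `FlatPortKernelRowsL0.kernelRowsAt_domT ∕ _of_adm22` for this one letter

Cell `ym3-torus` (HUMAN RULING D-0037, YM ladder rung R3), width seat `ym-ust-19936-w3` gen 4 (★★OWNER ym3-torus-plan g26 RULING (X1) 2026-08-28T04:53:12Z).
`--supports stmt-QuantumFields-19200 --as helper`; count-neutral; def-free.  Serves item 19936 `HistoryTailL` only through its (T) row (T8 ⇐ {H, EX}).

WHY.  `…FlatHCurlCurlSupRow.curlCurlSupRow_of_kernelRows` reads (X1) from the kernel row (k3) of `HKernelRows` and the PLAIN exponential row sum `Σ_c e^{−s·d(b,c)} ≤ K₀`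
([Balaban1984PropagatorsII] Lemma 2.1 (2.61)); the (162) row sum `RowSum162` of the P2 datum does not serve (left weight `w₁(b)`), and the P2 datum `KernelRowsAt` hides its
distance behind an `∃`.  So (X1) is certified here DIRECTLY at the port distance `d_T + 3` of a charted family: (k3) is `FlatPortHRows34L0.hRow3_of_portShapes` ((137) ∘
[Balaban1984PropagatorsII] Prop. 2.7 (2.149) `FlatPortProp27PadL0.prop27_kLevel_pad` ∘ Lemma 2.1 (2.63)), and the plain row sum is (2.61) of the SAME `lemma21_torus` call
composed with `B6Cor28KLevelV1L0.sum_comp_beta_le` (index bonds → carrier blocks, fibres ≤ 6) — the last five lines of `FlatPortRowSumL0.rowSum162_domT` without the level factor.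

WHAT IS PROVED (sorry-free; axioms standard; no definition).
* §1 ★ **`curlCurlSupRow_of_row3`** (abstract; any `F n K D`, weights, distance `dBI ≥ 0`, plain-function `H`): the row-3 kernel bound ALONE
  (`w₃(b)·|(∂^{η*}∂^ηHe_c)(b)| ≤ C·e^{−δ·dBI(b,c)}` for indicators `e_c`) + `∀ b, Σ_c e^{−s·dBI(b,c)} ≤ K₀` (`s ≤ δ`) ⟹ `∀ X t, 0 ≤ t → (∀ c, |X c| ≤ t) → ∀ b, w₃(b)·|(∂^{η*}∂^ηHX)(b)| ≤ C·K₀·t`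
  (linearity `HX = Σ_c X(c)·He_c`; the abstract four-row version is `…FlatHCurlCurlSupRow.curlCurlSupRow_of_kernelRows`, p606150);
* §2 ★ **`plainRowSum_domT`**: at a charted family, `Σ_c e^{−αδ₀·(d_T(y(b), β c) + 3)} ≤ 2·(2+1)·K261 N₀ 3 L 1 (αδ₀)` at every fine bond `b`, under `lemma21_torus`'s binders
  (`M_h ≥ 1`, `P′ ≥ 1`, `N₀ + 1 ≤ R·L·M_h`, the (2.59)-shape threshold at rate `αδ₀`);
* §3 ★★ **`curlCurlSupRow_domT (ℓ) (hL) (hℓ : 4 ≤ ℓ)`**: THERE ARE `M_h⁰, R₀ : ℕ` and `C_X ≥ 0` (functions of `L` only) such that for every volume exponent `m ≥ 1`, heights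
  `1 ≤ K − n`, `K − n + 1 ≤ m + K`, every torus family `D : TDomains 2 ℓ M_h (K−n) P′ R` charted by `hN` with `P′ = L·P″`, `P″ ≥ 5`, `M_h = Lᵃ ≥ M_h⁰`, `R ≥ R₀`, and every P2
  weight family `w`: `∀ X t, 0 ≤ t → (∀ c, |X c| ≤ t) → ∀ b, w 3 b·|(dcsE η⁻¹ (dcE η⁻¹ (toLp 2 (flatH F n K (domT hN D hk) X)))) b| ≤ C_X·t`
  (`C_X = (K₃e^{3r} + e^{r(ℓ+6)})·6·c63`, `r = (15/16)(δ₄/2)`, the constants of `kernelRowsAt_domT`'s row-3 block);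
  ★★ **`curlCurlSupRow_of_adm22`**: the same at EVERY `Adm22 D R (L·M_h)` family of the P2 text with `D.k = K − n`, `a′ + 3 ≤ m + n` (via `FlatPortChartL0.domT_tdOfAdmL0`).
The consumer of the P2 text (stub `stub_flatOpsCubeSeq`, whose dischargers are `kernelRowsAt_of_adm22` at these very data) reads (X1) at the same data with thresholds
`max` of the two `(M_h⁰, R₀)` pairs.
HONEST SCOPE: bookkeeping over landed certificates; inherits `L ≥ 5` (`4 ≤ ℓ`) and the `5L`-big-blocks chart condition of the lineage; constants crude; NOT a claim about the
mass gap.  YM₃ on the three-torus is rung R3 of the programme, not the Clay problem.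

References: T. Bałaban, CMP **96** (1984) 223–250 [Balaban1984PropagatorsII] Lemma 2.1 (2.59)–(2.63) pp.233–234, (2.46) p.231, Prop. 2.7 (2.149), Cor. 2.8 (2.151) p.249;
CMP **102** (1985) 277–309 [Balaban1985Variational] (88) p.291, (137)–(140) pp.298–299, (161)–(163) p.303.
-/

set_option autoImplicit false

noncomputable section

open scoped BigOperators InnerProductSpace

namespace Summit.QuantumFields.YangMills.Theorems.FlatPortCurlCurlSupRowL0

open Literature.MathematicalPhysics.QuantumFieldTheory.Balaban1983to89
open B6MultiLevelBoxOperator (N0)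
open B6MultiLevelTorusOperatorL0 (TDomains)
open B6Geom246MultiLevelBoxL0 (bset)
open B6Geom246MultiLevelTorusL0 (geomT bondT lemma21_torus)
open B6GlobalChartV1 (PV toBox)
open B6GlobalChartV1L0 (blkV1 domT)
open B6Ineq2142KLevelV1L0 (β)
open B6RandomWalk (delta3 delta3_pos)
open B6Ineq261LevelGap (K261 K261_nonneg)
open B6Cor28KLevelV1 (two_le_RMh)
open B6Cor28KLevelV1L0 (sum_comp_beta_le)
open B6QGQCoerciveKLevelV1 (gam0 gam0_pos)
open B6CubeWindowV1 (GlobalBand)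
open B6SectADomainsV1 (Domains)
open B6SectAOperatorsV1 (BondIdx dcE dcsE)
open T3ContinuumYM3Torus (T3Family)
open FlatCubeOpsText (IsLevWeight)
open FlatOpsLettersAssembly (flatH levWeight_nonneg)
open FlatOpsHRowsFromKernels (apply_eq_sum_indicator exists_indicator)
open FlatPortHRows12 (cf_ne_zero)
open FlatPortProp27PadL0 (prop27_kLevel_pad)
open FlatPortHRows34L0 (hRow3_of_portShapes)
open FlatPortKernelRows (theta_budget absorb_budget chart_params)
open FlatPortKernelRowsL0 (globalBand_unitWeights unitWeights_pos)

/-- `1 ≤ 3` (named once; every `domT`/`PV` below carries the same proof term). [folklore] -/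
private theorem hd3 : 1 ≤ 2 + 1 := by norm_num

/-! ## §1 (X1) from the row-3 kernel bound alone and a plain row sum (abstract) -/

section Abstract

variable {F : T3Family} {n K : ℕ} {D : Domains (F.P K)} {w : ℕ → PBond (F.P K) 0 → ℝ}
variable {dBI : PBond (F.P K) 0 → BondIdx D → ℝ} {H : (BondIdx D → ℝ) →ₗ[ℝ] (PBond (F.P K) 0 → ℝ)}

/-- ★ **(X1) FROM THE ROW-3 KERNEL BOUND ALONE AND A PLAIN ROW SUM**: if `w₃(b)·|(∂^{η*}∂^ηHe_c)(b)| ≤ C·e^{−δ·dBI(b,c)}` for every indicator `e_c` (`C ≥ 0`) and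
`Σ_c e^{−s·dBI(b,c)} ≤ K₀` at every `b` (`s ≤ δ`, `dBI ≥ 0`, `w₃ ≥ 0`), then `w₃(b)·|(∂^{η*}∂^ηHX)(b)| ≤ C·K₀·t` for all plain-sup data `|X(c)| ≤ t`, `t ≥ 0` (linearity
`HX = Σ_c X(c)·He_c`). [cite: Balaban1985Variational, (139)-(140) p.299, (161) p.303; Balaban1984PropagatorsII, Lemma 2.1 (2.61) p.234] -/
theorem curlCurlSupRow_of_row3 {C K₀ s δ : ℝ} (hC : 0 ≤ C) (hs : s ≤ δ) (hd0 : ∀ b c, 0 ≤ dBI b c) (hw3 : ∀ b, 0 ≤ w 3 b)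
    (hk3 : ∀ (c : BondIdx D) (e : BondIdx D → ℝ), e c = 1 → (∀ c', c' ≠ c → e c' = 0) → ∀ b : PBond (F.P K) 0,
      w 3 b * |(dcsE ((F.L : ℝ) ^ (K - n)) (dcE ((F.L : ℝ) ^ (K - n)) (WithLp.toLp 2 (H e)))) b| ≤ C * Real.exp (-(δ * dBI b c)))
    (hsum : ∀ b, ∑ c, Real.exp (-(s * dBI b c)) ≤ K₀) :
    ∀ (X : BondIdx D → ℝ) (t : ℝ), 0 ≤ t → (∀ c, |X c| ≤ t) → ∀ b : PBond (F.P K) 0,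
      w 3 b * |(dcsE ((F.L : ℝ) ^ (K - n)) (dcE ((F.L : ℝ) ^ (K - n)) (WithLp.toLp 2 (H X)))) b| ≤ C * K₀ * t := by
  intro X t ht hX b
  obtain ⟨e, he, he'⟩ := exists_indicator (ι := BondIdx D)
  -- `X ↦ (∂*∂ (HX))(b)` is linear; expand it against the indicators
  set T : (BondIdx D → ℝ) →ₗ[ℝ] (PBond (F.P K) 0 → ℝ) :=
    (WithLp.linearEquiv 2 ℝ (PBond (F.P K) 0 → ℝ)).toLinearMap ∘ₗ
      (dcsE (P := F.P K) ((F.L : ℝ) ^ (K - n)) ∘ₗ dcE (P := F.P K) ((F.L : ℝ) ^ (K - n))) ∘ₗ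
      (WithLp.linearEquiv 2 ℝ (PBond (F.P K) 0 → ℝ)).symm.toLinearMap ∘ₗ H with hT
  have hTapp : ∀ (Y : BondIdx D → ℝ) (b' : PBond (F.P K) 0),
      (dcsE ((F.L : ℝ) ^ (K - n)) (dcE ((F.L : ℝ) ^ (K - n)) (WithLp.toLp 2 (H Y)))) b' = T Y b' := fun _ _ => rfl
  rw [hTapp, apply_eq_sum_indicator T e he he' X b]
  calc w 3 b * |∑ c, X c * T (e c) b| ≤ w 3 b * ∑ c, |X c * T (e c) b| :=
        mul_le_mul_of_nonneg_left (Finset.abs_sum_le_sum_abs _ _) (hw3 b)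
    _ = ∑ c, |X c| * (w 3 b * |T (e c) b|) := by rw [Finset.mul_sum]; exact Finset.sum_congr rfl fun c _ => by rw [abs_mul]; ring
    _ ≤ ∑ c, |X c| * (C * Real.exp (-(δ * dBI b c))) := Finset.sum_le_sum fun c _ => by
        refine mul_le_mul_of_nonneg_left ?_ (abs_nonneg _)
        have h3 := hk3 c (e c) (he c) (he' c) b
        rwa [hTapp] at h3
    _ ≤ ∑ c, t * (C * Real.exp (-(s * dBI b c))) := Finset.sum_le_sum fun c _ => by
        refine mul_le_mul (hX c) (mul_le_mul_of_nonneg_left ?_ hC) (by positivity) ht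
        exact Real.exp_le_exp.2 (neg_le_neg (mul_le_mul_of_nonneg_right hs (hd0 b c)))
    _ = C * t * ∑ c, Real.exp (-(s * dBI b c)) := by rw [Finset.mul_sum]; exact Finset.sum_congr rfl fun c _ => by ring
    _ ≤ C * t * K₀ := mul_le_mul_of_nonneg_left (hsum b) (mul_nonneg hC ht)
    _ = C * K₀ * t := by ring

end Abstract

/-! ## §2 The plain (2.61) row sum at a charted family, over the port distance `d_T + 3` -/

section Carrier

variable (ℓ : ℕ) (hL : Odd (ℓ + 1) ∧ 1 < ℓ + 1) (m : ℕ) (hm : 1 ≤ m) (n K : ℕ)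
variable {Mh R : ℕ} {P' : Fin (2 + 1) → ℕ}
variable (hN : ∀ μ, N0 ℓ Mh (K - n) P' μ = (PV 2 ℓ m K hd3 hL).sitesPerDir 0) (D : TDomains 2 ℓ Mh (K - n) P' R) (hk : K - n ≤ m + K)

/-- ★ **THE PLAIN ROW SUM (2.61) OVER THE INDEX BONDS, AT THE PORT DISTANCE `d_T + 3`**: `Σ_c e^{−αδ₀(d_T(y(b), βc) + 3)} ≤ 2·(2+1)·K261 N₀ 3 L 1 (αδ₀)` at every fine bond `b`
(drop the `+3`, pass from index bonds to carrier blocks with fibres `≤ 6`, then `lemma21_torus`'s (2.61)). [cite: Balaban1984PropagatorsII, Lemma 2.1 (2.61) p.234, (2.45)-(2.46) p.231] -/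
theorem plainRowSum_domT (hMh : 1 ≤ Mh) (hP : ∀ μ, 1 ≤ P' μ) {δ₀ α : ℝ} (hδ₀ : 0 ≤ δ₀) (hα0 : 0 ≤ α) (hα1 : α ≤ 1) {N₀ : ℕ} (hN₀ : 0 < N₀)
    (hRM : N₀ + 1 ≤ R * ((ℓ + 1) * Mh)) (hθ : Real.exp (-(α * δ₀)) * ((ℓ : ℝ) + 1) ^ ((2 * (2 + 1 : ℕ) : ℝ) / N₀) < 1)
    (b : PBond (PV 2 ℓ m K hd3 hL) 0) :
    ∑ c : BondIdx (B6GlobalChartV1L0.domT (hd := hd3) hN D hk), Real.exp (-(α * δ₀ * (((bondT D).dist (blkV1 hN D b) (β hN D hk c) : ℝ) + 3))) ≤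
      2 * ((2 : ℝ) + 1) * K261 N₀ (2 + 1) ((ℓ : ℝ) + 1) 1 (α * δ₀) := by
  obtain ⟨-, h261, -, -⟩ := lemma21_torus (D := D) hMh hP hN₀ hRM hδ₀ hα0 hα1 hθ
  set y := blkV1 hN D b with hy
  have hαδ : 0 ≤ α * δ₀ := mul_nonneg hα0 hδ₀
  have hterm : ∀ c : BondIdx (domT (hd := hd3) hN D hk),
      Real.exp (-(α * δ₀ * (((bondT D).dist y (β hN D hk c) : ℝ) + 3))) ≤ Real.exp (-(α * δ₀ * (geomT D).dist y (β hN D hk c))) := by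
    intro c
    have hdist : (geomT D).dist y (β hN D hk c) = ((bondT D).dist y (β hN D hk c) : ℝ) := rfl
    rw [hdist]
    exact Real.exp_le_exp.2 (neg_le_neg (mul_le_mul_of_nonneg_left (by linarith) hαδ))
  have hsum := sum_comp_beta_le hN D hk (g := fun y' => Real.exp (-(α * δ₀ * (geomT D).dist y y'))) (fun y' => (Real.exp_pos _).le)
  calc ∑ c : BondIdx (domT (hd := hd3) hN D hk), Real.exp (-(α * δ₀ * (((bondT D).dist y (β hN D hk c) : ℝ) + 3)))
      ≤ ∑ c : BondIdx (domT (hd := hd3) hN D hk), Real.exp (-(α * δ₀ * (geomT D).dist y (β hN D hk c))) := Finset.sum_le_sum fun c _ => hterm c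
    _ ≤ 2 * ((2 : ℝ) + 1) * ∑ y', Real.exp (-(α * δ₀ * (geomT D).dist y y')) := hsum
    _ ≤ 2 * ((2 : ℝ) + 1) * K261 N₀ (2 + 1) ((ℓ : ℝ) + 1) 1 (α * δ₀) := mul_le_mul_of_nonneg_left (h261 y) (by norm_num)

end Carrier

/-! ## §3 (X1) at every charted family and at every `Adm22` family, constants from `L` alone -/

set_option maxHeartbeats 400000 in
/-- ★★ **(X1) AT EVERY CHARTED FAMILY OF THE d = 3 CARRIER, ODD `L ≥ 5`, `k ≥ 1`, CONSTANTS FROM `L` ALONE**: there are `M_h⁰, R₀` and `C_X ≥ 0` such that for every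
volume exponent `m ≥ 1`, heights `1 ≤ K − n`, `K − n + 1 ≤ m + K`, every torus family with `P′ = L·P″`, `P″ ≥ 5`, `M_h = Lᵃ ≥ M_h⁰`, `R ≥ R₀`, and every P2 weight family:
`w₃(b)·|(∂^{η*}∂^η flatH X)(b)| ≤ C_X·t` whenever `|X(c)| ≤ t` (`t ≥ 0`) — row (k3) of `hRow3_of_portShapes` ((137) ∘ Prop. 2.7 (2.149) ∘ (2.63)) summed with the plain (2.61) row
sum of the same Lemma-2.1 budget. [cite: Balaban1985Variational, (88) p.291, (137)-(140) pp.298-299, (161)-(163) p.303; Balaban1984PropagatorsII, Prop. 2.7 (2.149) p.249, Lemma 2.1 (2.61)-(2.63) p.234] -/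
theorem curlCurlSupRow_domT (ℓ : ℕ) (hL : Odd (ℓ + 1) ∧ 1 < ℓ + 1) (hℓ : 4 ≤ ℓ) :
    ∃ (Mh₀ R₀ : ℕ) (CX : ℝ), 0 ≤ CX ∧
    ∀ (m : ℕ) (hm : 1 ≤ m) (n K : ℕ) {Mh R : ℕ} {P' : Fin (2 + 1) → ℕ} (hN : ∀ μ, N0 ℓ Mh (K - n) P' μ = (PV 2 ℓ m K hd3 hL).sitesPerDir 0)
      (D : TDomains 2 ℓ Mh (K - n) P' R) (hk : K - n ≤ m + K) (_ : 1 ≤ K - n) (_ : K - n + 1 ≤ m + K)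
      {P'' : Fin (2 + 1) → ℕ} (_ : ∀ μ, P' μ = (ℓ + 1) * P'' μ) (_ : ∀ μ, 5 ≤ P'' μ)
      {a : ℕ} (_ : Mh = (ℓ + 1) ^ a) (_ : Mh₀ ≤ Mh) (_ : R₀ ≤ R)
      (w : ℕ → PBond (PV 2 ℓ m K hd3 hL) 0 → ℝ) (_ : IsLevWeight (⟨ℓ + 1, hL, m, hm⟩ : T3Family) n K (B6GlobalChartV1L0.domT hN D hk) w),
      ∀ (X : BondIdx (domT hN D hk) → ℝ) (t : ℝ), 0 ≤ t → (∀ c, |X c| ≤ t) → ∀ b : PBond (PV 2 ℓ m K hd3 hL) 0,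
        w 3 b * |(dcsE ((((ℓ + 1 : ℕ) : ℝ)) ^ (K - n)) (dcE ((((ℓ + 1 : ℕ) : ℝ)) ^ (K - n))
          (WithLp.toLp 2 (flatH (⟨ℓ + 1, hL, m, hm⟩ : T3Family) n K (domT hN D hk) X)))) b| ≤ CX * t := by
  -- the (2.149) package at the unit band `b₀ = b₁ = 1`
  obtain ⟨σb, hσb, hB⟩ := prop27_kLevel_pad 2 ℓ hd3 hL one_pos (le_refl (1 : ℝ))
  obtain ⟨A', M₂b, cc, N₁b, hA', hM₂b, hcc, hrowsB⟩ := hB σb hσb le_rfl (1 / 2) (by norm_num) (by norm_num)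
  -- the rates (verbatim from `kernelRowsAt_domT`'s row-3 block)
  set δ₃ : ℝ := delta3 (1 / 2) (2 * σb) with hδ₃
  have hδ₃0 : 0 < δ₃ := delta3_pos (by norm_num) (by linarith)
  set γ₀ : ℝ := gam0 2 ℓ 1 with hγ₀
  have hγ₀0 : 0 < γ₀ := gam0_pos 2 ℓ zero_le_one
  set δ₄ : ℝ := min (δ₃ / 4) (γ₀ / A' / (2 * (1 * (4 / δ₃) * (2 * ((2 : ℝ) + 1) * cc)) + 1)) with hδ₄
  have hδ₄0 : 0 < δ₄ := by
    refine lt_min (by linarith) (div_pos (div_pos hγ₀0 hA') ?_)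
    have : 0 ≤ 2 * (1 * (4 / δ₃) * (2 * ((2 : ℝ) + 1) * cc)) := by positivity
    linarith
  have hδ₄3 : δ₄ ≤ δ₃ := (min_le_left _ _).trans (by linarith)
  set r : ℝ := (1 - 1 / 16) * (δ₄ / 2) with hr
  have hr0 : 0 < r := by rw [hr]; positivity
  -- ONE Lemma-2.1 budget at rate `δ₄/2`, `α′ = 1/16`: (2.63) for the row, (2.61) for the plain sum
  obtain ⟨hN63pos, hθ63⟩ := theta_budget ℓ (show 0 < 1 / 16 * (δ₄ / 2) by positivity)
  set N63 : ℕ := ⌈2 * ((2 + 1 : ℕ) : ℝ) * Real.log ((ℓ : ℝ) + 1) / (1 / 16 * (δ₄ / 2))⌉₊ + 1 with hN63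
  set Na4 : ℕ := ⌈2 * ((2 : ℝ) + 3) * ((ℓ : ℝ) + 1) / δ₄⌉₊ with hNa4
  -- the constants
  set Lr : ℝ := (ℓ : ℝ) + 1 with hLr
  have hL1 : (1 : ℝ) ≤ Lr := by rw [hLr]; linarith [(Nat.cast_nonneg ℓ : (0 : ℝ) ≤ ℓ)]
  set c63 : ℝ := K261 N63 (2 + 1) Lr 1 (1 / 16 * (δ₄ / 2)) with hc63
  have hc630 : 0 ≤ c63 := K261_nonneg (by linarith : (0 : ℝ) ≤ Lr) zero_le_one
  set K₃ : ℝ := (2 / γ₀) * (2 * (((ℓ + 1 : ℕ) : ℝ)) ^ (2 + 1) * Real.exp (δ₃ * ((ℓ : ℝ) + 3))) * Lr ^ 2 * Lr ^ (2 + 3) * (2 * ((2 : ℝ) + 1)) * c63 ^ 2 with hK₃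
  have hK₃0 : 0 ≤ K₃ := by rw [hK₃]; positivity
  set C₃ : ℝ := K₃ * Real.exp (3 * r) + 1 * Real.exp (r * ((ℓ : ℝ) + 6)) with hC₃
  have hC₃0 : 0 ≤ C₃ := by positivity
  -- the thresholds on `M_h` and `R`
  set Mh₀ : ℕ := max 8 ⌈M₂b⌉₊ with hMh₀
  set R₀ : ℕ := max (2 * (ℓ + 1) ^ 2) (max (N₁b + 1) (max (N63 + 1) (Na4 + 1))) with hR₀
  refine ⟨Mh₀, R₀, C₃ * (2 * ((2 : ℝ) + 1) * c63), by positivity, ?_⟩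
  intro m hm n K Mh R P' hN D hk hk1 hk' P'' hLP hP5 a hMha hMh hR w hw
  -- unpack the thresholds
  have hM8 : 8 ≤ Mh := le_trans (le_max_left _ _) hMh
  have hMh1 : 1 ≤ Mh := le_trans (by norm_num) hM8
  have hR2 : 2 * (ℓ + 1) ^ 2 ≤ R := le_trans (le_max_left _ _) hR
  have hRMh : 2 ≤ R * Mh := two_le_RMh hR2 hM8
  have hRLM : ∀ {N : ℕ}, N + 1 ≤ R₀ → N + 1 ≤ R * ((ℓ + 1) * Mh) := fun {N} h =>
    le_trans (le_trans h hR) (Nat.le_mul_of_pos_right R (Nat.mul_pos (Nat.succ_pos ℓ) (by omega)))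
  have hN₁b : N₁b + 1 ≤ R * ((ℓ + 1) * Mh) := hRLM (le_trans (le_max_left _ _) (le_max_right _ _))
  have hN63' : N63 + 1 ≤ R * ((ℓ + 1) * Mh) := hRLM (le_trans (le_trans (le_max_left _ _) (le_max_right _ _)) (le_max_right _ _))
  have hNa4' : Na4 + 1 ≤ R * ((ℓ + 1) * Mh) := hRLM (le_trans (le_trans (le_max_right _ _) (le_max_right _ _)) (le_max_right _ _))
  have hM₂b' : M₂b ≤ ((ℓ : ℝ) + 1) * Mh := by
    have h0 : ⌈M₂b⌉₊ ≤ Mh := le_trans (le_max_right _ _) hMh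
    have h1 : M₂b ≤ (⌈M₂b⌉₊ : ℝ) := Nat.le_ceil _
    have h2 : (⌈M₂b⌉₊ : ℝ) ≤ (Mh : ℝ) := by exact_mod_cast h0
    have h3 : (Mh : ℝ) ≤ ((ℓ : ℝ) + 1) * Mh := le_mul_of_one_le_left (Nat.cast_nonneg _) hL1
    linarith
  have hP1 : ∀ μ, 1 ≤ P' μ := fun μ => by rw [hLP μ]; exact Nat.mul_pos (Nat.succ_pos ℓ) (by have := hP5 μ; omega)
  -- the band weights
  set ws : BondIdx (domT hN D hk) → ℝ := fun i =>
    ((((ℓ + 1 : ℕ) : ℝ)) ^ (K - n) / (((ℓ + 1 : ℕ) : ℝ)) ^ (i.1.1 : ℕ)) ^ 2 * ((((ℓ + 1 : ℕ) : ℝ)) ^ (i.1.1 : ℕ)) ^ (2 + 1) with hws_def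
  have hws : ∀ i, 0 < ws i := unitWeights_pos ℓ hL m n K hN D hk
  have hband : GlobalBand (Dm := domT hN D hk) 1 1 ((((ℓ + 1 : ℕ) : ℝ)) ^ (K - n)) ws := globalBand_unitWeights ℓ hL m n K hN D hk
  -- (2.149) at these data
  have h2149 := hrowsB m K hN D hk hk1 hk' hLP hP5 hMha hM8 hR2 hℓ hM₂b' hN₁b (cf_ne_zero ℓ n K) hws hband
  -- Lemma 2.1 on the torus at rate `δ₄/2`, `α′ = 1/16`: (2.61) AND (2.63)
  obtain ⟨-, -, -, h263⟩ := lemma21_torus (D := D) hMh1 hP1 hN63pos hN63' (show (0 : ℝ) ≤ δ₄ / 2 by positivity)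
    (by norm_num : (0 : ℝ) ≤ 1 / 16) (by norm_num : (1 : ℝ) / 16 ≤ 1) hθ63
  -- the absorption threshold at rate `δ₄`
  obtain ⟨hsm4, -, -⟩ := absorb_budget ℓ hδ₄0 hNa4'
  -- (k3) over `d_T + 3` at `(C₃, r)`
  have hk3 : ∀ (c : BondIdx (domT hN D hk)) (e : BondIdx (domT hN D hk) → ℝ), e c = 1 → (∀ c', c' ≠ c → e c' = 0) →
      ∀ b : PBond (PV 2 ℓ m K hd3 hL) 0,
        w 3 b * |(dcsE ((((ℓ + 1 : ℕ) : ℝ)) ^ (K - n)) (dcE ((((ℓ + 1 : ℕ) : ℝ)) ^ (K - n))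
          (WithLp.toLp 2 (flatH (⟨ℓ + 1, hL, m, hm⟩ : T3Family) n K (domT hN D hk) e)))) b| ≤
        C₃ * Real.exp (-(r * (((bondT D).dist (blkV1 hN D b) (β hN D hk c) : ℝ) + 3))) := by
    intro c e he he' b
    exact hRow3_of_portShapes ℓ hL m hm n K hN D hk hRMh hMh1 hP1 hws zero_le_one hband (by positivity) hδ₄0 hδ₄3
      (by norm_num : (1 : ℝ) / 16 ≤ 1) h2149 hsm4 h263 w hw c e he he' b
  -- the plain (2.61) row sum over `d_T + 3` at rate `(1/16)(δ₄/2) ≤ r`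
  have hsum : ∀ b : PBond (PV 2 ℓ m K hd3 hL) 0,
      ∑ c : BondIdx (domT hN D hk), Real.exp (-(1 / 16 * (δ₄ / 2) * (((bondT D).dist (blkV1 hN D b) (β hN D hk c) : ℝ) + 3))) ≤ 2 * ((2 : ℝ) + 1) * c63 :=
    fun b => plainRowSum_domT ℓ hL m n K hN D hk hMh1 hP1 (show (0 : ℝ) ≤ δ₄ / 2 by positivity) (by norm_num : (0 : ℝ) ≤ 1 / 16)
      (by norm_num : (1 : ℝ) / 16 ≤ 1) hN63pos hN63' hθ63 b
  have hs : 1 / 16 * (δ₄ / 2) ≤ r := by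
    rw [hr]; exact mul_le_mul_of_nonneg_right (by norm_num) (by positivity)
  have hd0 : ∀ (b : PBond (PV 2 ℓ m K hd3 hL) 0) (c : BondIdx (domT hN D hk)), (0 : ℝ) ≤ ((bondT D).dist (blkV1 hN D b) (β hN D hk c) : ℝ) + 3 :=
    fun _ _ => by positivity
  have hw3 : ∀ b : PBond (PV 2 ℓ m K hd3 hL) 0, 0 ≤ w 3 b := fun b => levWeight_nonneg hw 3 b
  -- assemble by linearity
  intro X t ht hX b
  exact curlCurlSupRow_of_row3 (F := (⟨ℓ + 1, hL, m, hm⟩ : T3Family)) (n := n) (K := K) (D := domT hN D hk) (w := w)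
    (dBI := fun b c => ((bondT D).dist (blkV1 hN D b) (β hN D hk c) : ℝ) + 3) (H := flatH (⟨ℓ + 1, hL, m, hm⟩ : T3Family) n K (domT hN D hk))
    hC₃0 hs hd0 hw3 hk3 hsum X t ht hX b

/-- ★★ **(X1) AT EVERY ADMISSIBLE FAMILY OF THE P2 TEXT** (level `0` admitted; via `FlatPortChartL0.tdOfAdmL0`∕`domT_tdOfAdmL0`): for odd `L = ℓ + 1 ≥ 5` there are `M_h⁰, R₀` and
`C_X ≥ 0` such that for all `m ≥ 1`, heights `1 ≤ K − n`, `K − n + 1 ≤ m + K`, big blocks `M = L·M_h`, `M_h = L^{a′} ≥ M_h⁰`, `R ≥ R₀`, torus size `a′ + 3 ≤ m + n`, every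
`D : Domains (F.P K)` with `D.k = K − n`, `Adm22 D R (L·M_h)`, and every P2 weight family: `∀ X t, 0 ≤ t → (∀ c, |X c| ≤ t) → ∀ b, w 3 b·|(∂^{η*}∂^η flatH F n K D X)(b)| ≤ C_X·t`
— the same data at which `FlatPortKernelRowsL0.kernelRowsAt_of_adm22` discharges P2's `KernelRowsAt` (take the max of the two threshold pairs).
[cite: Balaban1984PropagatorsII, (2.1)-(2.4) p.224, Prop. 2.7 (2.149) p.249, Lemma 2.1 (2.61)-(2.63) p.234; Balaban1985Variational, (88) p.291, (139)-(140) p.299, (161)-(163) p.303] -/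
theorem curlCurlSupRow_of_adm22 (ℓ : ℕ) (hL : Odd (ℓ + 1) ∧ 1 < ℓ + 1) (hℓ : 4 ≤ ℓ) :
    ∃ (Mh₀ R₀ : ℕ) (CX : ℝ), 0 ≤ CX ∧
    ∀ (m : ℕ) (hm : 1 ≤ m) (n K : ℕ) (_ : 1 ≤ K - n) (_ : K - n + 1 ≤ m + K) {Mh R a' : ℕ} (_ : Mh = (ℓ + 1) ^ a') (_ : Mh₀ ≤ Mh) (_ : R₀ ≤ R) (_ : a' + 3 ≤ m + n)
      (D : B6SectADomainsV1.Domains (PV 2 ℓ m K hd3 hL)) (_ : D.k = K - n) (_ : FlatCubeOpsText.Adm22 D R ((ℓ + 1) * Mh))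
      (w : ℕ → PBond (PV 2 ℓ m K hd3 hL) 0 → ℝ) (_ : IsLevWeight (⟨ℓ + 1, hL, m, hm⟩ : T3Family) n K D w),
      ∀ (X : BondIdx D → ℝ) (t : ℝ), 0 ≤ t → (∀ c, |X c| ≤ t) → ∀ b : PBond (PV 2 ℓ m K hd3 hL) 0,
        w 3 b * |(dcsE ((((ℓ + 1 : ℕ) : ℝ)) ^ (K - n)) (dcE ((((ℓ + 1 : ℕ) : ℝ)) ^ (K - n))
          (WithLp.toLp 2 (flatH (⟨ℓ + 1, hL, m, hm⟩ : T3Family) n K D X)))) b| ≤ CX * t := by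
  obtain ⟨Mh₀, R₀, CX, hCX, hmain⟩ := curlCurlSupRow_domT ℓ hL hℓ
  refine ⟨Mh₀, R₀, CX, hCX, ?_⟩
  intro m hm n K hk1 hk' Mh R a' hMha hMh hR hsize D hDk hAdm w hw
  have hk : K - n ≤ m + K := by omega
  obtain ⟨hN, hLP, hP5⟩ := chart_params ℓ m n K a' hL hℓ hk1 hsize
  rw [hMha] at hAdm
  have hN' : ∀ μ : Fin (2 + 1), N0 ℓ Mh (K - n) (fun _ => 2 * (ℓ + 1) ^ (m + n - 1 - a')) μ = (PV 2 ℓ m K hd3 hL).sitesPerDir 0 := by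
    rw [hMha]; exact hN
  rw [← hMha] at hAdm
  set D' := FlatPortChartL0.tdOfAdmL0 hN' D hDk hk hAdm with hD'
  have hEq : domT hN' D' hk = D := FlatPortChartL0.domT_tdOfAdmL0 hN' D hDk hk hAdm
  rw [← hEq] at hw ⊢
  exact hmain m hm n K hN' D' hk hk1 hk' hLP hP5 hMha hMh hR w hw

end Summit.QuantumFields.YangMills.Theorems.FlatPortCurlCurlSupRowL0

end
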